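import Literature.Probability.RandomPlanarGeometry.SLETraceCriterionProofs
import HarnessLib

/-!
# SLE₈ is generated by a curve: Lawler–Schramm–Werner's Theorem 4.7 and the tree's `hasSLETrace_eight`

Trunk T-STOCH. The named fact `Literature.Probability.RandomPlanarGeometry.hasSLETrace_eight`
(`Literature/Probability/RandomPlanarGeometry/SLE.lean`: chordal SLE₈ is almost surely generated
by a curve) is Theorem 4.7 of Lawler–Schramm–Werner, *Conformal invariance of planar
loop-erased random walks and uniform spanning trees*, Ann. Probab. 32 (2004), p. 980:

> **Theorem 4.7 (Chordal SLE₈ traces a path).** Let `gₜ` denote the chordal SLE₈ process driven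
> by `B(8t)`, where `B(t)` is standard Brownian motion. Then, a.s. for every `t > 0`, the map
> `gₜ⁻¹` extends continuously to `ℍ̄` and `γ(t) := gₜ⁻¹(B(8t))` is a.s. continuous. Moreover,
> a.s. `gₜ⁻¹(ℍ)` is the unbounded component of `ℍ ∖ γ[0, t]` for every `t ≥ 0`.

This file

* **proves** that the theorem **as printed**, rendered on the canonical space of `SLE.lean`
  (driving process `sleDriving 8 ω = √8 Bₜ(ω)`, which has the law of `B(8t)` by Brownian
  scaling), is *the same proposition* as the tree's
  `Literature.Probability.RandomPlanarGeometry.hasSLETrace_eight`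
  (`Literature.Probability.RandomPlanarGeometry.LawlerSchrammWerner2004_thm47_iff_hasSLETrace_eight`;
  the printed form is written out in full there and is deliberately *not* a second named fact —
  it carries exactly the proof obligation of `hasSLETrace_eight`). The equivalence is
  deterministic, driving function by driving function
  (`Literature.Probability.RandomPlanarGeometry.Loewner.exists_isGeneratedByCurve_iff_exists_extension`):
  the direction "printed ⇒ generated by a curve" is bookkeeping (`fₜ = gₜ⁻¹` is the identity at
  `t = 0`, maps `ℍ̄` into `ℍ̄`, and `Kₜ = ℍ ∖ gₜ⁻¹(ℍ)`); the converse uses the deterministic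
  theory proved in the tree — for a chain generated by a curve the complement of `j(Hₜ)`,
  `j(z) = (z + i)⁻¹`, is locally connected along the boundary
  (`Loewner.IsGeneratedByCurve.locallyConnected_compl_image`, `LoewnerTraceLimit`), so
  Carathéodory's continuity theorem (`ConformalEquiv.continuousOn_extendFrom_of_lc`,
  `CaratheodoryLC`) extends `fₜ` continuously to `ℍ̄`
  (`Loewner.IsGeneratedByCurve.continuousOn_extendFrom_loewnerInv`, new here: the limit of `fₜ`
  exists at *every* real point, not only at the tip preimage `W t`), with value `γ(t)` at `W(t)`
  (`Loewner.IsGeneratedByCurve.tendsto_invFunOn_map`);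
* records the architecture of the printed proof (p. 981):
  1. `Literature.Probability.RandomPlanarGeometry.LawlerSchrammWerner2004_lemma314_maps`,
     `Literature.Probability.RandomPlanarGeometry.LawlerSchrammWerner2004_lemma314_kernel` —
     the two statements of **Lemma 3.14 (Convergence relations)**, p. 967, in the chordal
     setting ("the chordal analog of Lemma 3.14, which is valid with the same proof", p. 981):
     if `Wₙ → W` locally uniformly then `fₜⁿ → fₜ` locally uniformly on `[0, ∞) × ℍ` (continuous
     dependence of ODE solutions on parameters) — **PROVED** here,
     `Literature.Probability.RandomPlanarGeometry.LawlerSchrammWerner2004_lemma314_maps_holds`,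
     from a Grönwall estimate for the backward flow
     (`Literature.Probability.RandomPlanarGeometry.Loewner.norm_loewnerInv_sub_loewnerInv_le_of_driving`:
     `|f^U_t(z) - f^V_t(z)| ≤ e^{8t/y²} sup_{[0,t]} |U - V|` for `im z ≥ y`); and if moreover
     `fₜⁿ(ℍ)` is the unbounded component of `ℍ ∖ γₙ[0, t]` for curves `γₙ → γ` locally uniformly,
     then `fₜ(ℍ)` is the unbounded component of `ℍ ∖ γ[0, t]` (Carathéodory kernel theorem,
     Pommerenke (1992) Thm. 1.8) — stated here, **PROVED** in `SLETraceEightKernel.lean`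
     (`LawlerSchrammWerner2004_lemma314_kernel_holds`, from `Montel`/`Hurwitz`);
  2. the probabilistic input — **Theorem 4.4** (driving process convergence, p. 976: the Loewner
     driving process of the conformal image `γ̂ = φ_R ∘ γ` of the UST Peano curve, parametrized
     by capacity, is close to `B(8t)` in a coupling) and **Proposition 4.5** (uniform continuity
     estimate, p. 977: tightness of the `γ̂` in `C([0, ∞))`) — lives with the uniform spanning
     tree Peano curve of the grid approximations `D^R ∈ 𝔇*` of §4.1/§4.3 (`LSW2004UST.lean` and
     its `…Proofs`/`…Rado`/`…UniformContinuity`/`…Lemma46Forms` companions), not here;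
  3. the assembly (p. 981): tightness + Prokhorov give a subsequential weak limit `(γ*, W*)` of
     `(γ̂, W)` with `W* = B(8·)` in law; Lemma 3.14 (the set of pairs `(γ, W)` with `fₜ(ℍ)` the
     unbounded component of `ℍ ∖ γ[0,t]` for all `t` is closed) and the portmanteau theorem put
     the limit law on that set; the `W`-marginal statement is `hasSLETrace_eight`
     (`Literature.Probability.RandomPlanarGeometry.Loewner.isGeneratedByCurve_of_image_loewnerInv_eq`
     below turns the conclusion of Lemma 3.14 into `Loewner.IsGeneratedByCurve`); carried out in
     `SLETraceApproximation.lean` / `SLETraceEightAssembly.lean` and, down to Thm. 4.4 and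
     Prop. 4.5 as printed, in `SLETraceEightOfUST.lean` / `SLETraceEightOfThm44.lean`.

Mathlib has Brownian motion predicates but no Loewner chains / SLE; everything named `Loewner.*`
comes from the Literature files imported above.

## References

* G. F. Lawler, O. Schramm, W. Werner, *Conformal invariance of planar loop-erased random walks
  and uniform spanning trees*, Ann. Probab. 32 (2004) 939–995 (= Selected works of O. Schramm,
  Springer (2011), 931–987; arXiv:math/0112234): Lemma 2.1 (p. 951), Lemma 3.14 (p. 967),
  Thm. 4.4 (p. 976), §4.3 and Prop. 4.5 (p. 977), Thm. 4.7, Thm. 4.8 (p. 980) and their proof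
  (p. 981).
* S. Rohde, O. Schramm, *Basic properties of SLE*, Ann. of Math. 161 (2005), Thm. 4.1, Thm. 5.1
  (the case `κ ≠ 8`; "the particular case `κ = 8` could not be handled there", [LSW04] p. 981).
* Ch. Pommerenke, *Boundary Behaviour of Conformal Maps*, Springer (1992), Thm. 1.8 (kernel
  theorem), Thm. 2.1 (continuity theorem).
* G. F. Lawler, *Conformally Invariant Processes in the Plane*, AMS (2005), §4.4, Prop. 4.31,
  Rem. 4.32.
-/

noncomputable section

open Set Filter Topology Metric Complex MeasureTheory
open UpperHalfPlane (upperHalfPlaneSet isOpen_upperHalfPlaneSet)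
open scoped NNReal

namespace Literature.Probability.RandomPlanarGeometry

namespace Loewner

variable {W : ℝ≥0 → ℝ} {γ : ℝ≥0 → ℂ} {z : ℂ}

/-! ### `fₜ = gₜ⁻¹` at time `0` and its image -/

/-- `f₀ = id` on `ℍₒ` (`g₀ = id`, `LoewnerFlow.map_zero_apply`). [folklore] -/
theorem loewnerInv_zero_apply (hW : Continuous W) (hz : 0 < z.im) : loewnerInv W 0 z = z := by
  have hmap : map W 0 (loewnerInv W 0 z) = z := map_loewnerInv hW 0 hz
  rwa [map_zero_apply hW (ne_driving_of_lt_swallowingTime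
    (lt_swallowingTime_loewnerInv hW 0 hz))] at hmap

/-- `fₜ(ℍₒ) = Hₜ` (`LoewnerFlow.bijOn_invFunOn_map`). [folklore] -/
theorem image_loewnerInv (hW : Continuous W) (t : ℝ≥0) :
    loewnerInv W t '' upperHalfPlaneSet = domain W t :=
  (bijOn_invFunOn_map hW t).image_eq

/-- For a chain generated by `γ`, `fₜ(ℍₒ)` is the unbounded component of `ℍₒ ∖ γ[0, t]` — the
form in which [LSW04] state "generated by a curve" (Thm. 4.7, Lemma 3.14).
[cite: LawlerSchrammWerner2004, Thm. 4.7] -/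
theorem IsGeneratedByCurve.image_loewnerInv_eq (hγ : IsGeneratedByCurve W γ) (hW : Continuous W)
    (t : ℝ≥0) :
    loewnerInv W t '' upperHalfPlaneSet = unboundedComponent (upperHalfPlaneSet \ γ '' Icc 0 t) := by
  rw [image_loewnerInv hW t, hγ.domain_eq t]

/-- Conversely, a continuous curve in `ℍ̄ₒ` from `W 0` such that `fₜ(ℍₒ)` is the unbounded
component of `ℍₒ ∖ γ[0, t]` for every `t` generates the chain (the conclusion of Lemma 3.14 in
the vocabulary of `Loewner.IsGeneratedByCurve`). [cite: LawlerSchrammWerner2004, Lemma 3.14] -/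
theorem isGeneratedByCurve_of_image_loewnerInv_eq (hW : Continuous W) (hγc : Continuous γ)
    (h0 : γ 0 = W 0) (him : ∀ t, 0 ≤ (γ t).im)
    (h : ∀ t, loewnerInv W t '' upperHalfPlaneSet =
      unboundedComponent (upperHalfPlaneSet \ γ '' Icc 0 t)) :
    IsGeneratedByCurve W γ := by
  refine ⟨hγc, h0, him, fun t ↦ ?_⟩
  rw [← h t, image_loewnerInv hW t, domain, sdiff_sdiff_cancel_left (hull_subset W t)]

/-! ### `fₜ` extends continuously to the closed half-plane (chains generated by a curve) -/

/-- **`fₜ` has a limit within `ℍₒ` at every real point** when the chain (continuous driving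
function) is generated by a curve: Carathéodory's continuity theorem
(`ConformalEquiv.continuousOn_extendFrom_of_lc`) for the conformal map `Φ = j ∘ fₜ ∘ cayley⁻¹`
of `𝔻` onto the bounded domain `j(Hₜ)`, `j(z) = (z + i)⁻¹`, whose complement is locally
connected along the boundary (`IsGeneratedByCurve.locallyConnected_compl_image`); the limit of
`j ∘ fₜ` at `x` is non-zero since `fₜ` is bounded near `x`, so `fₜ = k ∘ (j ∘ fₜ)`,
`k(w) = w⁻¹ - i`, converges. (The proof of `IsGeneratedByCurve.exists_tendsto_invFunOn_map`,
`LoewnerTraceLimit`, run at an arbitrary real point instead of `W t`.) Lawler (2005),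
Prop. 4.31 / Rem. 4.32; [LSW04] p. 981 ("elementary properties of conformal maps imply that
`gₜ⁻¹` extends continuously to `ℍ̄`", citing Pommerenke (1992), Thm. 2.1).
[cite: PommerenkeBBCM1992, Thm. 2.1] -/
theorem IsGeneratedByCurve.exists_tendsto_loewnerInv_ofReal (hγ : IsGeneratedByCurve W γ)
    (hW : Continuous W) (t : ℝ≥0) (x : ℝ) :
    ∃ p : ℂ, Tendsto (loewnerInv W t) (𝓝[upperHalfPlaneSet] (x : ℂ)) (𝓝 p) := by
  haveI := neBot_nhdsWithin_ofReal x
  set F := loewnerInv W t with hFdef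
  set H := domain W t with hHdef
  set j : ℂ → ℂ := fun z ↦ (z + I)⁻¹ with hjdef
  set G := j '' H with hGdef
  have hHsub : H ⊆ upperHalfPlaneSet := domain_subset W t
  have hne : ∀ z ∈ H, z + I ≠ 0 := fun z hz ↦ add_I_ne_zero (le_of_lt (hHsub hz))
  -- the three conformal equivalences `𝔻 → ℍₒ → Hₜ → j(Hₜ)`
  set ψ : ConformalEquiv upperHalfPlaneSet H := (ConformalEquiv.ofBijOn (map W t)
    (differentiableOn_map hW t) (bijOn_map hW t) (differentiableOn_invFunOn_map hW t)).symm with hψ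
  have hjd : DifferentiableOn ℂ j H := (differentiableOn_id.add_const I).inv hne
  have hjinj : InjOn j H := fun z₁ _ z₂ _ h ↦ add_right_cancel (inv_inj.1 h)
  have hjbij : BijOn j H G := ⟨mapsTo_image j H, hjinj, surjOn_image j H⟩
  have hG0 : ∀ w ∈ G, w ≠ 0 := by
    rintro _ ⟨z, hz, rfl⟩
    exact inv_ne_zero (hne z hz)
  have hjinv : DifferentiableOn ℂ (Function.invFunOn j H) G := by
    have hk : DifferentiableOn ℂ (fun w : ℂ ↦ w⁻¹ - I) G :=
      (differentiableOn_inv.mono fun w hw ↦ hG0 w hw).sub_const I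
    refine hk.congr fun w hw ↦ ?_
    have h2 : j (Function.invFunOn j H w) = w := Function.invFunOn_eq hw
    calc Function.invFunOn j H w = (j (Function.invFunOn j H w))⁻¹ - I :=
          (inv_inv_add_I_sub_I _).symm
      _ = w⁻¹ - I := by rw [h2]
  set J : ConformalEquiv H G := ConformalEquiv.ofBijOn j hjd hjbij hjinv with hJ
  set Φ : ConformalEquiv (ball (0 : ℂ) 1) G := (cayley.symm.trans ψ).trans J with hΦdef
  have hΦ : ∀ w, Φ w = (F (cayleyInvFun w) + I)⁻¹ := fun w ↦ rfl
  -- Carathéodory's continuity theorem for `Φ`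
  have hGopen : IsOpen G := isOpen_image_inv_add_I_domain hW t
  have hGb : Bornology.IsBounded G :=
    isBounded_closedBall.subset (image_inv_add_I_domain_subset t)
  obtain ⟨-, -, hT⟩ := ConformalEquiv.continuousOn_extendFrom_of_lc Φ hGopen hGb
    (hγ.locallyConnected_compl_image hW t)
  set x₀ : ℂ := cayleyFun x with hx₀
  have hx₀mem : x₀ ∈ closedBall (0 : ℂ) 1 :=
    mem_closedBall_zero_iff.2 (norm_cayleyFun_ofReal _).le
  have hC : Tendsto cayleyFun (𝓝[upperHalfPlaneSet] (x : ℂ)) (𝓝[ball 0 1] x₀) := by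
    have h0 : ((x : ℝ) : ℂ) + I ≠ 0 := add_I_ne_zero (by simp)
    have hcx : ContinuousWithinAt cayleyFun upperHalfPlaneSet (x : ℂ) :=
      ((continuousOn_cayleyFun _ h0).continuousAt
        ((isOpen_ne_fun (continuous_id.add continuous_const) continuous_const).mem_nhds
          h0)).continuousWithinAt
    exact hcx.tendsto_nhdsWithin fun z hz ↦ cayley.mapsTo hz
  set p' : ℂ := extendFrom (ball 0 1) Φ x₀ with hp'
  have h1 : Tendsto (fun z ↦ (F z + I)⁻¹) (𝓝[upperHalfPlaneSet] (x : ℂ)) (𝓝 p') := by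
    refine ((hT x₀ hx₀mem).comp hC).congr' ?_
    filter_upwards [self_mem_nhdsWithin] with z hz
    rw [Function.comp_apply, hΦ, cayleyInvFun_cayleyFun (add_I_ne_zero (le_of_lt hz))]
  -- the limit is not `0 = j(∞)`: `F` is bounded near `x`
  obtain ⟨R', C, hbd⟩ := exists_forall_norm_invFunOn_map_le hW t
  set B : ℝ := max (max R' (‖(x : ℂ)‖ + 1 + C)) 0 + 1 with hB
  have hev : ∀ᶠ z in 𝓝[upperHalfPlaneSet] (x : ℂ), (B + 1)⁻¹ ≤ ‖(F z + I)⁻¹‖ := by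
    filter_upwards [inter_mem_nhdsWithin upperHalfPlaneSet (ball_mem_nhds _ one_pos)] with z hz
    have hzn : ‖z‖ ≤ ‖(x : ℂ)‖ + 1 := by
      have h3 := mem_ball_iff_norm.1 hz.2
      have h4 := norm_le_norm_add_norm_sub' z (x : ℂ)
      linarith [norm_sub_rev z (x : ℂ)]
    have hFz : ‖F z‖ ≤ B := by
      refine (hbd z hz.1).trans ?_
      have h3 : max R' (‖z‖ + C) ≤ max R' (‖(x : ℂ)‖ + 1 + C) :=
        max_le_max le_rfl (by linarith)
      have h4 : max R' (‖(x : ℂ)‖ + 1 + C) ≤ max (max R' (‖(x : ℂ)‖ + 1 + C)) 0 :=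
        le_max_left _ _
      rw [hB]; linarith
    have hFzH : F z ∈ H := (bijOn_invFunOn_map hW t).mapsTo hz.1
    rw [norm_inv]
    refine inv_anti₀ (norm_pos_iff.2 (hne _ hFzH)) ?_
    calc ‖F z + I‖ ≤ ‖F z‖ + ‖I‖ := norm_add_le _ _
      _ ≤ B + 1 := by rw [norm_I]; linarith
  have hp'0 : p' ≠ 0 := by
    have hle : (B + 1)⁻¹ ≤ ‖p'‖ := ge_of_tendsto h1.norm hev
    have hB1 : 0 < B + 1 := by
      have : (0 : ℝ) ≤ max (max R' (‖(x : ℂ)‖ + 1 + C)) 0 := le_max_right _ _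
      rw [hB]; linarith
    exact norm_pos_iff.1 (lt_of_lt_of_le (by positivity) hle)
  -- conclude with the continuity of `k w = w⁻¹ - i` at `p'`
  refine ⟨p'⁻¹ - I, ?_⟩
  have hk : ContinuousAt (fun w : ℂ ↦ w⁻¹ - I) p' :=
    (continuousAt_inv₀ hp'0).sub continuousAt_const
  refine (hk.tendsto.comp h1).congr fun z ↦ ?_
  exact inv_inv_add_I_sub_I (F z)

/-- `fₜ` has a limit within `ℍₒ` at every point of the closed half-plane (interior points:
continuity, `continuousAt_loewnerInv`; real points: `exists_tendsto_loewnerInv_ofReal`).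
[cite: PommerenkeBBCM1992, Thm. 2.1] -/
theorem IsGeneratedByCurve.exists_tendsto_loewnerInv (hγ : IsGeneratedByCurve W γ)
    (hW : Continuous W) (t : ℝ≥0) {x : ℂ} (hx : x ∈ closure upperHalfPlaneSet) :
    ∃ p : ℂ, Tendsto (loewnerInv W t) (𝓝[upperHalfPlaneSet] x) (𝓝 p) := by
  rcases (mem_closure_upperHalfPlaneSet_iff.1 hx).eq_or_lt with h0 | hpos
  · have hxre : ((x.re : ℝ) : ℂ) = x := Complex.ext rfl (by simpa using h0)
    rw [← hxre]
    exact hγ.exists_tendsto_loewnerInv_ofReal hW t x.re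
  · exact ⟨_, (continuousAt_loewnerInv hW t hpos).tendsto.mono_left nhdsWithin_le_nhds⟩

/-- **Continuous extension of `fₜ = gₜ⁻¹` to `ℍ̄ₒ`** for a chain generated by a curve:
`extendFrom ℍₒ fₜ` is continuous on the closed half-plane. [LSW04] p. 981; Lawler (2005),
Prop. 4.31 / Rem. 4.32; Pommerenke (1992), Thm. 2.1. [cite: PommerenkeBBCM1992, Thm. 2.1] -/
theorem IsGeneratedByCurve.continuousOn_extendFrom_loewnerInv (hγ : IsGeneratedByCurve W γ)
    (hW : Continuous W) (t : ℝ≥0) :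
    ContinuousOn (extendFrom upperHalfPlaneSet (loewnerInv W t)) (closure upperHalfPlaneSet) :=
  continuousOn_extendFrom subset_rfl fun _ hx ↦ hγ.exists_tendsto_loewnerInv hW t hx

/-- The extension agrees with `fₜ` on `ℍₒ`. [folklore] -/
theorem extendFrom_loewnerInv_eq (hW : Continuous W) (t : ℝ≥0) (hz : 0 < z.im) :
    extendFrom upperHalfPlaneSet (loewnerInv W t) z = loewnerInv W t z :=
  extendFrom_extends (differentiableOn_invFunOn_map hW t).continuousOn z hz

/-- The extension takes the value `γ(t)` at the driving point `W(t)` (the tip is the boundary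
limit, `IsGeneratedByCurve.tendsto_invFunOn_map`). Lawler (2005), Prop. 4.31.
[cite: Lawler2005, Prop. 4.31] -/
theorem IsGeneratedByCurve.extendFrom_loewnerInv_driving (hγ : IsGeneratedByCurve W γ)
    (hW : Continuous W) (t : ℝ≥0) :
    extendFrom upperHalfPlaneSet (loewnerInv W t) (W t) = γ t :=
  extendFrom_eq (mem_closure_upperHalfPlaneSet_iff.2 (by simp)) (hγ.tendsto_invFunOn_map hW t)

/-! ### Stability of `fₜ` in the driving function -/

/-- **Stability of `fₜ = gₜ⁻¹` in the driving function** (Grönwall): if `U, V` are continuous,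
`|U - V| ≤ ε` on `[0, t]` and `im z ≥ y > 0`, then `|f^U_t(z) - f^V_t(z)| ≤ e^{8t/y²} ε`. Both
backward trajectories from `z` solve the truncated backward field of `U` (`bwdField`, globally
`2/m²`-Lipschitz, `m = y/2`) up to an error `2ε/m²`; Mathlib `dist_le_of_approx_trajectories_ODE`
(cf. `norm_loewnerInvAt_sub_le`, the same estimate at the moving point `U t + iy`). This is the
"continuous dependence of solutions of ODE on the parameters" step of [LSW04] Lemma 3.14.
[cite: LawlerSchrammWerner2004, Lemma 3.14 (proof)] -/
theorem norm_loewnerInv_sub_loewnerInv_le_of_driving {U V : ℝ≥0 → ℝ} (hU : Continuous U)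
    (hV : Continuous V) (t : ℝ≥0) {y : ℝ} (hy : 0 < y) {z : ℂ} (hz : y ≤ z.im) {ε : ℝ}
    (hUV : ∀ u : ℝ≥0, u ≤ t → |U u - V u| ≤ ε) :
    ‖loewnerInv U t z - loewnerInv V t z‖ ≤ Real.exp (8 / y ^ 2 * t) * ε := by
  have hε0 : 0 ≤ ε := (abs_nonneg _).trans (hUV 0 zero_le)
  have hzpos : 0 < z.im := hy.trans_le hz
  -- the common truncation level `m = y/2`
  set m : ℝ≥0 := ⟨y / 2, by positivity⟩ with hmdef
  have hm : 0 < m := by change (0 : ℝ) < y / 2; positivity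
  have hm' : (m : ℝ) = y / 2 := rfl
  have hwz : (m : ℝ) < z.im := by rw [hm']; linarith
  obtain ⟨hU', hU0, hUc, hUd, hUim, hUdom, hUmap⟩ := exists_backward_solution hU t hm hwz
  obtain ⟨hV', hV0, hVc, hVd, hVim, hVdom, hVmap⟩ := exists_backward_solution hV t hm hwz
  have hΘU : loewnerInv U t z = hU' t := invFunOn_map_eq hU hzpos hUdom hUmap
  have hΘV : loewnerInv V t z = hV' t := invFunOn_map_eq hV hzpos hVdom hVmap
  rw [hΘU, hΘV, ← dist_eq_norm]
  -- both are (approximate) solutions of the truncated field of `U`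
  set K : ℝ≥0 := 2 / m ^ 2 with hK
  have hKpos : (0 : ℝ) < K := by rw [hK]; push_cast; positivity
  have hderiv : ∀ {X : ℝ≥0 → ℝ} {h : ℝ → ℂ},
      (∀ s ∈ Icc (0 : ℝ) t, HasDerivWithinAt h (-vectorField X ((t : ℝ) - s) (h s))
        (Icc (-1 : ℝ) t) s) →
      (∀ s ∈ Icc (0 : ℝ) t, (m : ℝ) ≤ (h s).im) →
      ∀ s ∈ Ico (0 : ℝ) t, HasDerivWithinAt h (bwdField X t m s (h s)) (Ici s) s := by
    intro X h hd him s hs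
    have h1 := (hd s ⟨hs.1, hs.2.le⟩).mono (Icc_subset_Icc_left (by linarith [hs.1]) :
      Icc s (t : ℝ) ⊆ Icc (-1 : ℝ) t)
    have h2 := h1.mono_of_mem_nhdsWithin (Icc_mem_nhdsGE hs.2)
    rwa [bwdField, liftIm_of_le (him s ⟨hs.1, hs.2.le⟩)]
  have hUim' : ∀ s ∈ Icc (0 : ℝ) t, (m : ℝ) ≤ (hU' s).im := fun s hs ↦ hwz.le.trans (hUim s hs)
  have hVim' : ∀ s ∈ Icc (0 : ℝ) t, (m : ℝ) ≤ (hV' s).im := fun s hs ↦ hwz.le.trans (hVim s hs)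
  have key := dist_le_of_approx_trajectories_ODE (v := bwdField U t m) (K := K)
    (f := hU') (g := hV') (f' := fun s ↦ bwdField U t m s (hU' s))
    (g' := fun s ↦ bwdField V t m s (hV' s)) (a := 0) (b := t) (εf := 0) (εg := 2 / m ^ 2 * ε)
    (δ := 0) (fun s ↦ lipschitzWith_bwdField hm U t s) hUc.continuousOn (hderiv hUd hUim')
    (fun s _ ↦ by simp) hVc.continuousOn (hderiv hVd hVim')
    (fun s hs ↦ by
      rw [dist_eq_norm]
      exact norm_bwdField_sub_bwdField_le hm hUV ⟨hs.1, hs.2.le⟩ (hV' s))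
    (by rw [hU0, hV0, dist_self])
    t ⟨t.coe_nonneg, le_rfl⟩
  refine key.trans ?_
  rw [gronwallBound_of_K_ne_0 hKpos.ne', zero_add, sub_zero]
  simp only [zero_mul, zero_add]
  have hKm : (K : ℝ) = 8 / y ^ 2 := by
    rw [hK]; push_cast; rw [hm']; field_simp; ring
  rw [show (2 : ℝ) / (m : ℝ) ^ 2 = K by rw [hK]; push_cast; ring, hKm]
  have h8 : (0 : ℝ) < 8 / y ^ 2 := by positivity
  have hexp : 1 ≤ Real.exp (8 / y ^ 2 * t) := Real.one_le_exp (by positivity)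
  calc 8 / y ^ 2 * ε / (8 / y ^ 2) * (Real.exp (8 / y ^ 2 * t) - 1)
      = ε * (Real.exp (8 / y ^ 2 * t) - 1) := by field_simp
    _ ≤ Real.exp (8 / y ^ 2 * t) * ε := by nlinarith

end Loewner

/-! ### Theorem 4.7 as printed is `hasSLETrace_eight` -/

namespace Loewner

variable {W : ℝ≥0 → ℝ}

/-- **"Generated by a curve" in the printed form of [LSW04] Thm. 4.7, deterministic version.**
For a continuous driving function `W`, the chain `(gₜ)` is generated by a curve
(`∃ γ, IsGeneratedByCurve W γ`: a continuous `γ` in `ℍ̄ₒ` from `W 0` with `Hₜ = ℍₒ ∖ Kₜ` the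
unbounded component of `ℍₒ ∖ γ[0, t]`) iff, as in the statement of Thm. 4.7, every `fₜ = gₜ⁻¹`
"extends continuously to `ℍ̄`" (an `F t` continuous on `closure ℍₒ` and equal to `fₜ` on `ℍₒ`),
`t ↦ F t (W t)` is continuous, and `fₜ(ℍₒ)` is the unbounded component of
`ℍₒ ∖ {F s (W s) : s ≤ t}` for every `t`. (⇒: `F t = extendFrom ℍₒ fₜ`,
`IsGeneratedByCurve.continuousOn_extendFrom_loewnerInv`, whose value at `W t` is `γ t`; ⇐:
`isGeneratedByCurve_of_image_loewnerInv_eq` — `γ(0) = W(0)` because `F 0 = f₀ = id` on `ℍₒ`,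
hence on `ℍ̄ₒ` by continuity, and `im γ ≥ 0` because `F t` maps `ℍ̄ₒ` into
`closure (fₜ(ℍₒ)) ⊆ ℍ̄ₒ`.) [cite: LawlerSchrammWerner2004, Thm. 4.7] -/
theorem exists_isGeneratedByCurve_iff_exists_extension (hW : Continuous W) :
    (∃ γ, IsGeneratedByCurve W γ) ↔
    ∃ F : ℝ≥0 → ℂ → ℂ,
      (∀ t, ContinuousOn (F t) (closure upperHalfPlaneSet) ∧
        EqOn (F t) (loewnerInv W t) upperHalfPlaneSet) ∧
      Continuous (fun t ↦ F t (W t)) ∧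
      ∀ t, loewnerInv W t '' upperHalfPlaneSet =
        unboundedComponent (upperHalfPlaneSet \ (fun s ↦ F s (W s)) '' Icc 0 t) := by
  have hcl : ∀ s : ℝ≥0, ((W s : ℝ) : ℂ) ∈ closure upperHalfPlaneSet := fun s ↦
    mem_closure_upperHalfPlaneSet_iff.2 (by simp)
  constructor
  · rintro ⟨γ, hγ⟩
    have hγeq : (fun t ↦ extendFrom upperHalfPlaneSet (loewnerInv W t) (W t)) = γ :=
      funext fun t ↦ hγ.extendFrom_loewnerInv_driving hW t
    refine ⟨fun t ↦ extendFrom upperHalfPlaneSet (loewnerInv W t), fun t ↦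
      ⟨hγ.continuousOn_extendFrom_loewnerInv hW t, fun z hz ↦ extendFrom_loewnerInv_eq hW t hz⟩,
      ?_, fun t ↦ ?_⟩
    · rw [hγeq]
      exact hγ.continuous
    · rw [hγeq]
      exact hγ.image_loewnerInv_eq hW t
  · rintro ⟨F, hF, hγc, hdom⟩
    refine ⟨fun t ↦ F t (W t), isGeneratedByCurve_of_image_loewnerInv_eq hW hγc ?_ (fun t ↦ ?_)
      hdom⟩
    · -- `γ 0 = W 0`
      have h1 : EqOn (F 0) id upperHalfPlaneSet := fun w hw ↦ by
        rw [(hF 0).2 hw]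
        exact loewnerInv_zero_apply hW hw
      have h2 : EqOn (F 0) id (closure upperHalfPlaneSet) :=
        h1.of_subset_closure (hF 0).1 continuousOn_id subset_closure subset_rfl
      exact h2 (hcl 0)
    · -- `0 ≤ im (γ t)`
      have h1 : F t '' closure upperHalfPlaneSet ⊆ closure upperHalfPlaneSet := by
        refine ((hF t).1.image_closure).trans (closure_mono ?_)
        rw [(hF t).2.image_eq, image_loewnerInv hW t]
        exact domain_subset W t
      exact mem_closure_upperHalfPlaneSet_iff.1 (h1 ⟨_, hcl t, rfl⟩)

end Loewner

/-- **Lawler–Schramm–Werner (2004), Theorem 4.7 (Chordal SLE₈ traces a path) as printed ⇒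
`hasSLETrace_eight`.** Thm. 4.7, p. 980: "Let `gₜ` denote the chordal SLE₈ process driven by
`B(8t)`, where `B(t)` is standard Brownian motion. Then, a.s. for every `t > 0`, the map `gₜ⁻¹`
extends continuously to `ℍ̄` and `γ(t) := gₜ⁻¹(B(8t))` is a.s. continuous. Moreover, a.s.
`gₜ⁻¹(ℍ)` is the unbounded component of `ℍ ∖ γ[0, t]` for every `t ≥ 0`." The hypothesis `h` is
this statement rendered on the canonical space of `SLE.lean`: the driving process is
`ξ = sleDriving 8 ω = √8 B(ω)` (same law as `t ↦ B(8t)`, Brownian scaling), `gₜ` is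
`Loewner.map ξ t`, `gₜ⁻¹ = fₜ` is `Loewner.loewnerInv ξ t` on `ℍₒ`, "extends continuously to `ℍ̄`"
is the existence of `F t`, continuous on `closure ℍₒ` and equal to `fₜ` on `ℍₒ` (stated for all
`t ≥ 0`, the case `t = 0` being trivial as `g₀ = id`), `γ(t) := F t (ξ t)`, and "the unbounded
component" is `Loewner.unboundedComponent` (the union of the unbounded components of
`ℍₒ ∖ γ[0, t]`; there is exactly one, `isConnected_unboundedComponent`). The printed statement
is thus *the same proposition* as the tree's `hasSLETrace_eight`
(`LawlerSchrammWerner2004_thm47_iff_hasSLETrace_eight`), not a separate fact.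
[cite: LawlerSchrammWerner2004, Thm. 4.7] -/
theorem hasSLETrace_eight_of_LawlerSchrammWerner2004_thm47
    (h : ∀ᵐ ω ∂Process.preWienerMeasure, ∃ F : ℝ≥0 → ℂ → ℂ,
      (∀ t, ContinuousOn (F t) (closure upperHalfPlaneSet) ∧
        EqOn (F t) (Loewner.loewnerInv (sleDriving 8 ω) t) upperHalfPlaneSet) ∧
      Continuous (fun t ↦ F t (sleDriving 8 ω t)) ∧
      ∀ t, Loewner.loewnerInv (sleDriving 8 ω) t '' upperHalfPlaneSet =
        Loewner.unboundedComponent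
          (upperHalfPlaneSet \ (fun s ↦ F s (sleDriving 8 ω s)) '' Icc 0 t)) :
    hasSLETrace_eight := by
  change HasSLETrace 8
  filter_upwards [h] with ω hω
  exact (Loewner.exists_isGeneratedByCurve_iff_exists_extension (continuous_sleDriving 8 ω)).2 hω

/-- **`hasSLETrace_eight` ⇒ [LSW04] Theorem 4.7 as printed**: if the chain of `ξ = √8 B` is
generated by `γ`, then `F t := extendFrom ℍₒ fₜ` is a continuous extension of `fₜ` to `ℍ̄ₒ`
(`Loewner.IsGeneratedByCurve.continuousOn_extendFrom_loewnerInv`) with `F t (ξ t) = γ t`, and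
`fₜ(ℍₒ) = Hₜ` is the unbounded component of `ℍₒ ∖ γ[0, t]`.
[cite: LawlerSchrammWerner2004, Thm. 4.7] -/
theorem LawlerSchrammWerner2004_thm47_of_hasSLETrace_eight (h : hasSLETrace_eight) :
    ∀ᵐ ω ∂Process.preWienerMeasure, ∃ F : ℝ≥0 → ℂ → ℂ,
      (∀ t, ContinuousOn (F t) (closure upperHalfPlaneSet) ∧
        EqOn (F t) (Loewner.loewnerInv (sleDriving 8 ω) t) upperHalfPlaneSet) ∧
      Continuous (fun t ↦ F t (sleDriving 8 ω t)) ∧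
      ∀ t, Loewner.loewnerInv (sleDriving 8 ω) t '' upperHalfPlaneSet =
        Loewner.unboundedComponent
          (upperHalfPlaneSet \ (fun s ↦ F s (sleDriving 8 ω s)) '' Icc 0 t) := by
  have h' : HasSLETrace 8 := h
  filter_upwards [h'] with ω hω
  exact (Loewner.exists_isGeneratedByCurve_iff_exists_extension (continuous_sleDriving 8 ω)).1 hω

/-- **[LSW04] Theorem 4.7 as printed (on the canonical space, driving process `√8 B`) is exactly
`Literature.Probability.RandomPlanarGeometry.hasSLETrace_eight`.**
[cite: LawlerSchrammWerner2004, Thm. 4.7] -/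
theorem LawlerSchrammWerner2004_thm47_iff_hasSLETrace_eight :
    (∀ᵐ ω ∂Process.preWienerMeasure, ∃ F : ℝ≥0 → ℂ → ℂ,
      (∀ t, ContinuousOn (F t) (closure upperHalfPlaneSet) ∧
        EqOn (F t) (Loewner.loewnerInv (sleDriving 8 ω) t) upperHalfPlaneSet) ∧
      Continuous (fun t ↦ F t (sleDriving 8 ω t)) ∧
      ∀ t, Loewner.loewnerInv (sleDriving 8 ω) t '' upperHalfPlaneSet =
        Loewner.unboundedComponent
          (upperHalfPlaneSet \ (fun s ↦ F s (sleDriving 8 ω s)) '' Icc 0 t)) ↔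
    hasSLETrace_eight :=
  ⟨hasSLETrace_eight_of_LawlerSchrammWerner2004_thm47,
    LawlerSchrammWerner2004_thm47_of_hasSLETrace_eight⟩

/-! ### The deterministic ingredient of the printed proof: Lemma 3.14 (chordal) -/

/-- **Lawler–Schramm–Werner (2004), Lemma 3.14 (Convergence relations), first statement**,
p. 967, chordal analogue (p. 981: "the chordal analog of Lemma 3.14, which is valid with the
same proof"): "Suppose `Wₙ`, `W` are continuous functions from `[0, ∞)` to `ℝ` such that
`Wₙ → W` locally uniformly. Let `gₜⁿ`, `gₜ` be the corresponding solutions to Loewner's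
(chordal) equation and set `fₜⁿ = (gₜⁿ)⁻¹`, `fₜ = gₜ⁻¹`. Then `fₜⁿ → fₜ` locally uniformly on
`[0, ∞) × ℍ`." (Printed proof: `fₜ` is obtained by flowing along the reversed field, so this is
continuous dependence of ODE solutions on parameters.) Here `fₜ = Loewner.loewnerInv W t` on
`ℍₒ`. [cite: LawlerSchrammWerner2004, Lemma 3.14] -/
def LawlerSchrammWerner2004_lemma314_maps : Prop :=
  ∀ {Wn : ℕ → ℝ≥0 → ℝ} {W : ℝ≥0 → ℝ}, (∀ n, Continuous (Wn n)) → Continuous W →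
    TendstoLocallyUniformly Wn W atTop →
    TendstoLocallyUniformlyOn (fun n (p : ℝ≥0 × ℂ) ↦ Loewner.loewnerInv (Wn n) p.1 p.2)
      (fun p ↦ Loewner.loewnerInv W p.1 p.2) atTop (univ ×ˢ upperHalfPlaneSet)

/-- **[LSW04] Lemma 3.14, first statement, PROVED** (chordal): `fₜⁿ → fₜ` locally uniformly on
`[0, ∞) × ℍₒ` when `Wₙ → W` locally uniformly — about `(t₀, z₀)`, on the neighbourhood
`[0, t₀ + 1] × {im z > im z₀ / 2}`, by the Grönwall estimate
`Loewner.norm_loewnerInv_sub_loewnerInv_le_of_driving` and uniform convergence of `Wₙ` on the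
compact interval `[0, t₀ + 1]`. [cite: LawlerSchrammWerner2004, Lemma 3.14] -/
theorem LawlerSchrammWerner2004_lemma314_maps_holds : LawlerSchrammWerner2004_lemma314_maps := by
  intro Wn W hWn hW hlim
  rw [Metric.tendstoLocallyUniformlyOn_iff]
  rintro ε hε ⟨t₀, z₀⟩ ⟨-, hz₀⟩
  have hy₀ : 0 < z₀.im := hz₀
  set y : ℝ := z₀.im / 2 with hy
  have hypos : 0 < y := by positivity
  set T : ℝ≥0 := t₀ + 1 with hT
  set C : ℝ := Real.exp (8 / y ^ 2 * T) with hC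
  have hCpos : 0 < C := Real.exp_pos _
  -- the neighbourhood `[0, T] × {im > y}` of `(t₀, z₀)`
  refine ⟨Iic T ×ˢ {z : ℂ | y < z.im}, ?_, ?_⟩
  · refine mem_nhdsWithin_of_mem_nhds (prod_mem_nhds ?_ ?_)
    · exact mem_of_superset (Iio_mem_nhds (by rw [hT]; exact lt_add_one t₀)) Iio_subset_Iic_self
    · exact (isOpen_lt continuous_const Complex.continuous_im).mem_nhds (by
        change y < z₀.im; rw [hy]; linarith)
  · -- uniform convergence of `Wₙ` on the compact `[0, T]`
    have hunif : TendstoUniformlyOn Wn W atTop (Icc 0 T) :=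
      (tendstoLocallyUniformly_iff_forall_isCompact.1 hlim) _ isCompact_Icc
    have hη : 0 < ε / (2 * C) := by positivity
    filter_upwards [(Metric.tendstoUniformlyOn_iff.1 hunif) _ hη] with n hn
    rintro ⟨t, z⟩ ⟨ht, hz⟩
    have ht' : t ≤ T := ht
    have hz' : y < z.im := hz
    have hUV : ∀ u : ℝ≥0, u ≤ t → |W u - Wn n u| ≤ ε / (2 * C) := fun u hu ↦ by
      have := hn u ⟨zero_le, hu.trans ht'⟩
      rw [Real.dist_eq] at this
      exact this.le
    have hest := Loewner.norm_loewnerInv_sub_loewnerInv_le_of_driving hW (hWn n) t hypos hz'.le hUV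
    rw [dist_eq_norm]
    calc ‖Loewner.loewnerInv W t z - Loewner.loewnerInv (Wn n) t z‖
        ≤ Real.exp (8 / y ^ 2 * t) * (ε / (2 * C)) := hest
      _ ≤ C * (ε / (2 * C)) := by
          gcongr
          rw [hC]
          exact Real.exp_le_exp.2 (by gcongr)
      _ = ε / 2 := by field_simp
      _ < ε := by linarith

/-- **Lawler–Schramm–Werner (2004), Lemma 3.14 (Convergence relations), second statement**,
p. 967, chordal analogue (p. 981), continuing `LawlerSchrammWerner2004_lemma314_maps`: "If there
are continuous curves `γₙ : [0, ∞) → ℍ̄` such that for all `t ≥ 0` the image of `fₜⁿ` is the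
unbounded component of `ℍ ∖ γₙ[0, t]`, and there is a `γ : [0, ∞) → ℍ̄` such that `γₙ → γ`
locally uniformly on `[0, ∞)`, then for all `t ≥ 0` the image of `fₜ` is the unbounded
component of `ℍ ∖ γ[0, t]`." (Printed proof: the Carathéodory kernel theorem, Pommerenke (1992)
Thm. 1.8.) With `Loewner.isGeneratedByCurve_of_image_loewnerInv_eq` the conclusion says that
the limit chain is generated by `γ`. [cite: LawlerSchrammWerner2004, Lemma 3.14] -/
def LawlerSchrammWerner2004_lemma314_kernel : Prop :=
  ∀ {Wn : ℕ → ℝ≥0 → ℝ} {W : ℝ≥0 → ℝ} {γn : ℕ → ℝ≥0 → ℂ} {γ : ℝ≥0 → ℂ},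
    (∀ n, Continuous (Wn n)) → Continuous W → TendstoLocallyUniformly Wn W atTop →
    (∀ n, Continuous (γn n)) → (∀ n t, 0 ≤ (γn n t).im) →
    (∀ n t, Loewner.loewnerInv (Wn n) t '' upperHalfPlaneSet =
      Loewner.unboundedComponent (upperHalfPlaneSet \ γn n '' Icc 0 t)) →
    (∀ t, 0 ≤ (γ t).im) → TendstoLocallyUniformly γn γ atTop →
    ∀ t, Loewner.loewnerInv W t '' upperHalfPlaneSet =
      Loewner.unboundedComponent (upperHalfPlaneSet \ γ '' Icc 0 t)

/-- Sanity check on the hypothesis of Lemma 3.14: it holds for every chain generated by a curve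
(e.g. for the chains of the approximating simple curves `γ̂ = φ_R ∘ γ_R` of [LSW04] §4.3).
[cite: LawlerSchrammWerner2004, Lemma 3.14] -/
theorem LawlerSchrammWerner2004_lemma314_hypothesis {W : ℝ≥0 → ℝ} {γ : ℝ≥0 → ℂ}
    (hγ : Loewner.IsGeneratedByCurve W γ) (hW : Continuous W) (t : ℝ≥0) :
    Loewner.loewnerInv W t '' upperHalfPlaneSet =
      Loewner.unboundedComponent (upperHalfPlaneSet \ γ '' Icc 0 t) :=
  hγ.image_loewnerInv_eq hW t

/-- **The limit step of the printed proof of Thm. 4.7** (p. 981), deterministic part, from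
Lemma 3.14: if continuous driving functions `Wₙ → W` and curves `γₙ → γ` converge locally
uniformly, each chain `(Wₙ)` being generated by `γₙ`, then the chain of `W` is generated by
`γ`. [cite: LawlerSchrammWerner2004, proof of Thm. 4.7] -/
theorem Loewner.isGeneratedByCurve_of_tendstoLocallyUniformly
    (h314 : LawlerSchrammWerner2004_lemma314_kernel)
    {Wn : ℕ → ℝ≥0 → ℝ} {W : ℝ≥0 → ℝ} {γn : ℕ → ℝ≥0 → ℂ} {γ : ℝ≥0 → ℂ}
    (hWn : ∀ n, Continuous (Wn n)) (hW : Continuous W) (hWlim : TendstoLocallyUniformly Wn W atTop)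
    (hgen : ∀ n, Loewner.IsGeneratedByCurve (Wn n) (γn n))
    (hγlim : TendstoLocallyUniformly γn γ atTop) :
    Loewner.IsGeneratedByCurve W γ := by
  have hγnc : ∀ n, Continuous (γn n) := fun n ↦ (hgen n).continuous
  have hγc : Continuous γ := hγlim.continuous (Frequently.of_forall hγnc)
  -- pointwise limits
  have hpt : ∀ t, Tendsto (fun n ↦ γn n t) atTop (𝓝 (γ t)) := fun t ↦
    hγlim.tendstoLocallyUniformlyOn.tendsto_at (mem_univ t)
  have hptW : ∀ t, Tendsto (fun n ↦ Wn n t) atTop (𝓝 (W t)) := fun t ↦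
    hWlim.tendstoLocallyUniformlyOn.tendsto_at (mem_univ t)
  have him : ∀ t, 0 ≤ (γ t).im := fun t ↦
    ge_of_tendsto ((Complex.continuous_im.tendsto _).comp (hpt t))
      (Eventually.of_forall fun n ↦ (hgen n).im_nonneg t)
  have h0 : γ 0 = W 0 := by
    have h1 : Tendsto (fun n ↦ γn n 0) atTop (𝓝 ((W 0 : ℝ) : ℂ)) := by
      have := (Complex.continuous_ofReal.tendsto _).comp (hptW 0)
      refine this.congr fun n ↦ ?_
      simp [(hgen n).apply_zero]
    exact tendsto_nhds_unique (hpt 0) h1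
  exact Loewner.isGeneratedByCurve_of_image_loewnerInv_eq hW hγc h0 him
    (h314 hWn hW hWlim hγnc (fun n t ↦ (hgen n).im_nonneg t)
      (fun n t ↦ (hgen n).image_loewnerInv_eq (hWn n) t) him hγlim)

end Literature.Probability.RandomPlanarGeometry
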